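import Summits.ABC.ABC.Theses.CuspFieldPencil
import Summits.ABC.ABC.Theorems.GoldenFieldClassNumberOne
import Summits.ABC.ABC.Theorems.CuspFieldPencilGoldenFromNFPencil
import Literature.Barriers.ABC.BakerMethodBounds
import Literature.Barriers.ABC.BakerMethodBoundsThreeRoutesProofs
import Literature.NumberTheory.DiophantineGeometry.MatveevYuPlaceBoundsNumberField
import Literature.NumberTheory.DiophantineGeometry.AbcTwoAdicValuationProofs
import Literature.NumberTheory.DiophantineGeometry.PastenSubexpGenerators
import Literature.NumberTheory.EllipticCurves.HeightsBaseChangeProofs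

/-! Sketch (planner, stub-ideation k3 **g4**, family 3 = PROBE THE EXTREMES) for `stub_conjugateCuspTriple`
(crux stmt-ABC-26026 `GoldenCuspShadow`, route-ABC-CuspFieldPencil). Statements only (`sorry` bodies) except
`ring`/`norm_num` sanity and sorry-free compositions.

WHAT IS NEW IN g4 ("Plan Q♭", crude-place Yu). The stub's exponent `2/3` on `rad Q` is EXACTLY the slack that lets the
non-archimedean half be proved with the CRUDE place cost `N𝔭 ≤ p^[K:ℚ] = p²` at an ARBITRARY prime `𝔭 ⊇ (p)` of `𝓞_K`,
`K = ℚ(√5)`: `min(m, rad(Q)²) ≤ rad(Q)^{2/3}·m^{2/3}` (`m = min(rad u, rad w)`, from the ℚ-line `UWHalf`). Consequences: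
g3's splitting lemma Q5b (`p ∤ 10` splits, `N𝔭 = p`, `e = 1`, `ord_𝔭 x₊ = v_p Q`) is DELETED; the Yu step needs only the four
valuation facts V1–V5 below (existence of `𝔭 ∋ p`, `N𝔭 ≤ p²`, `v_p(n)·log p ≤ −log|n|_𝔭`, `|m|_𝔭 = 1` for `p ∤ m`, `|ω|_𝔭 = 1`)
and is applied to BOTH conjugates `x₊ = ω⁵w·Λ₊`, `x₋ = −ω⁻⁵w·Λ₋` at the same `𝔭` (`Q = x₊x₋`). AUTOPSY of g3: Q4c's first
identity had a sign error (`x₊ = +φ⁵w·((u/w)φ⁻⁵ − 1)`, not `−`); corrected here (A3). The archimedean half (Matveev at the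
real place, g3 Q4/Q4d) is unchanged and restated by signature. -/

set_option linter.dupNamespace false

namespace Summit.ABC.ABC.Cruxes.GoldenCuspShadow.ConjugateK3G4

open UniqueFactorizationMonoid Literature.Barriers.ABC NumberField QuadraticAlgebra Height Finset
open Summit.ABC.ABC.Theses.CuspFieldPencil
open Literature.NumberTheory.DiophantineGeometry.Dioph (matveev2000_linearFormsLog_nf yu2007_padicLogForm_logB_nf)

/-! ### 0 · Statements (integer-facing) -/

/-- The registered stub signature, verbatim (payload.stub.signature). -/
def Sig : Prop :=
  ∀ ε : ℝ, 0 < ε → ∃ κ : ℝ, ∀ u w : ℤ, IsCoprime u w → u * w * (u ^ 2 - 11 * u * w - w ^ 2) ≠ 0 → Real.log (max (|(u : ℝ)|) (|(w : ℝ)|)) ≤ κ * (((UniqueFactorizationMonoid.radical (u * w * (u ^ 2 - 11 * u * w - w ^ 2))).natAbs : ℕ) : ℝ) ^ (ε : ℝ) * ((((UniqueFactorizationMonoid.radical (u ^ 2 - 11 * u * w - w ^ 2)).natAbs : ℕ) : ℝ) ^ (2 / 3 : ℝ) * (min (((UniqueFactorizationMonoid.radical u).natAbs : ℕ) : ℝ)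 (((UniqueFactorizationMonoid.radical w).natAbs : ℕ) : ℝ)) ^ (2 / 3 : ℝ))

/-- The unconditional ℚ-line, verbatim k2-g3 `UWHalf` (= split-k2 `CuspMinRadBound`, `Iff.rfl`):
`log H ≤ κ_δ R^δ · min(rad u, rad w)` (from `approximationBound_rat_holds`). -/
def UWHalf : Prop :=
  ∀ δ : ℝ, 0 < δ → ∃ κ : ℝ, ∀ u w : ℤ, IsCoprime u w → u * w * (u ^ 2 - 11 * u * w - w ^ 2) ≠ 0 →
    Real.log (max (|(u : ℝ)|) (|(w : ℝ)|)) ≤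
      κ * (((radical (u * w * (u ^ 2 - 11 * u * w - w ^ 2))).natAbs : ℕ) : ℝ) ^ δ *
        min (((radical u).natAbs : ℕ) : ℝ) (((radical w).natAbs : ℕ) : ℝ)

/-- g3 Q0′ verbatim (archimedean half, K-arch, mod Matveev-NF): `2 log H ≤ log|Q| + κ_δ rad(uw)^δ log(2 + log H)`. -/
def QNotSmall : Prop :=
  ∀ δ : ℝ, 0 < δ → ∃ κ : ℝ, ∀ u w : ℤ, IsCoprime u w → u * w * (u ^ 2 - 11 * u * w - w ^ 2) ≠ 0 →
    2 * Real.log (max (|(u : ℝ)|) (|(w : ℝ)|)) ≤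
      Real.log (|((u ^ 2 - 11 * u * w - w ^ 2 : ℤ) : ℝ)|) +
        κ * (((radical (u * w)).natAbs : ℕ) : ℝ) ^ δ *
          Real.log (2 + Real.log (max (|(u : ℝ)|) (|(w : ℝ)|)))

/-- NEW Q0″♭ (non-archimedean half with the CRUDE place cost): `log|Q| ≤ κ_δ rad(uw)^δ · rad(Q)² · log(2 + log H)`. -/
def QUpperSq : Prop :=
  ∀ δ : ℝ, 0 < δ → ∃ κ : ℝ, ∀ u w : ℤ, IsCoprime u w → u * w * (u ^ 2 - 11 * u * w - w ^ 2) ≠ 0 →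
    Real.log (|((u ^ 2 - 11 * u * w - w ^ 2 : ℤ) : ℝ)|) ≤
      κ * (((radical (u * w)).natAbs : ℕ) : ℝ) ^ δ *
        (((radical (u ^ 2 - 11 * u * w - w ^ 2)).natAbs : ℕ) : ℝ) ^ 2 *
          Real.log (2 + Real.log (max (|(u : ℝ)|) (|(w : ℝ)|)))

/-- NEW Q0♭ (the squared K-datum): `log H ≤ κ_ε R^ε · rad(Q)²`. -/
def QSideRadSq : Prop :=
  ∀ ε : ℝ, 0 < ε → ∃ κ : ℝ, ∀ u w : ℤ, IsCoprime u w → u * w * (u ^ 2 - 11 * u * w - w ^ 2) ≠ 0 →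
    Real.log (max (|(u : ℝ)|) (|(w : ℝ)|)) ≤
      κ * (((radical (u * w * (u ^ 2 - 11 * u * w - w ^ 2))).natAbs : ℕ) : ℝ) ^ (ε : ℝ) *
        (((radical (u ^ 2 - 11 * u * w - w ^ 2)).natAbs : ℕ) : ℝ) ^ 2

/-! ### 1 · Real-arithmetic assemblies -/

/-- A1 (XS, PROVED here): `min(m, q²) ≤ q^{2/3}·m^{2/3}` for `m, q ≥ 0` (`M = M^{1/3}M^{2/3} ≤ (q²)^{1/3} m^{2/3}`). -/
theorem min_sq_le_rpow_mul_rpow {m q : ℝ} (hm : 0 ≤ m) (hq : 0 ≤ q) :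
    min m (q ^ 2) ≤ q ^ (2 / 3 : ℝ) * m ^ (2 / 3 : ℝ) := by
  set M := min m (q ^ 2) with hM
  have hM0 : 0 ≤ M := le_min hm (sq_nonneg q)
  have h1 : M ≤ m := min_le_left _ _
  have h2 : M ≤ q ^ 2 := min_le_right _ _
  have key : M = M ^ (1 / 3 : ℝ) * M ^ (2 / 3 : ℝ) := by
    rw [← Real.rpow_add' hM0 (by norm_num : (1 / 3 : ℝ) + 2 / 3 ≠ 0)]
    norm_num
  have e1 : M ^ (1 / 3 : ℝ) ≤ (q ^ 2) ^ (1 / 3 : ℝ) := Real.rpow_le_rpow hM0 h2 (by norm_num)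
  have e2 : M ^ (2 / 3 : ℝ) ≤ m ^ (2 / 3 : ℝ) := Real.rpow_le_rpow hM0 h1 (by norm_num)
  have e3 : (q ^ 2) ^ (1 / 3 : ℝ) = q ^ (2 / 3 : ℝ) := by
    rw [← Real.rpow_two, ← Real.rpow_mul hq]
    norm_num
  calc M = M ^ (1 / 3 : ℝ) * M ^ (2 / 3 : ℝ) := key
    _ ≤ (q ^ 2) ^ (1 / 3 : ℝ) * m ^ (2 / 3 : ℝ) :=
        mul_le_mul e1 e2 (Real.rpow_nonneg hM0 _) (Real.rpow_nonneg (sq_nonneg q) _)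
    _ = q ^ (2 / 3 : ℝ) * m ^ (2 / 3 : ℝ) := by rw [e3]

/-- A2 (S, = g3 Q1a): self-improvement `x ≤ A·log(2 + x)`, `A ≥ 1`, `x ≥ 0` ⇒ `x ≤ 2A·log(A + 11)`. -/
theorem selfImprove {x A : ℝ} (hx : 0 ≤ x) (hA : 1 ≤ A) (h : x ≤ A * Real.log (2 + x)) :
    x ≤ 2 * A * Real.log (A + 11) := by
  sorry

/-- A4 (S): the two halves give the squared K-datum: add Q0′ and Q0″♭ at `δ = ε/3`, `rad(uw) ≤ R`, `rad Q ≥ 1`,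
then A2 with `A = κ R^{ε/3} rad(Q)²` and `log(A + 11) ≤ C_ε R^{ε/3}` (`Real.log_le_rpow_div`, `rad Q ≤ R`). -/
theorem qSideRadSq_of_qNotSmall_of_qUpperSq (h₁ : QNotSmall) (h₂ : QUpperSq) : QSideRadSq := by
  sorry

/-- A5 (S): `UWHalf ∧ QSideRadSq ⇒ THIS STUB`: both at `ε`, `log H ≤ κ R^ε · min(m, rad(Q)²)` (`min_le_min` of the two
bounds after normalising `κ := max κ₁ κ₂ ≥ 0`), then A1 with `m = min(rad u, rad w) ≥ 0`, `q = rad Q ≥ 0`. -/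
theorem sig_of_uwHalf_of_qSideRadSq (h₁ : UWHalf) (h₂ : QSideRadSq) : Sig := by
  sorry

/-! ### 2 · The archimedean half (g3 Q4, mod Matveev-NF) — restated; Q4c sign corrected -/

/-- A3 (XS, PROVED here by `field_simp; ring`): the Λ-forms over `ℝ` (g3 Q4c with the sign of the first identity CORRECTED):
`x₊ = u − φ⁵w = φ⁵w·((u/w)φ⁻⁵ − 1)` and `x₋ = u + φ⁻⁵w = −φ⁻⁵w·((−u/w)φ⁵ − 1)`. -/
theorem conj_lambda_form (u w : ℝ) (hw : w ≠ 0) :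
    u - Real.goldenRatio ^ 5 * w = (Real.goldenRatio ^ 5 * w) * (u / w * (Real.goldenRatio⁻¹) ^ 5 - 1) ∧
      u + (Real.goldenRatio⁻¹) ^ 5 * w =
        -((Real.goldenRatio⁻¹) ^ 5 * w) * (-u / w * Real.goldenRatio ^ 5 - 1) := by
  have hφ : Real.goldenRatio ≠ 0 := Real.goldenRatio_pos.ne'
  constructor
  · field_simp
  · field_simp
    ring

/-- Q4d (M−, g3 verbatim, THE ARCHIMEDEAN LOAD-BEARING STEP): instance of the PROVED place bound
`Dioph.evertseGyory2022_prop_4_2_4_infinite_nf_of_matveev hM` at `K = QuadraticAlgebra ℚ 1 1`, the real place `ω ↦ φ`,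
`α = (−1, ω, p | uw)`, `b = (0/1, −s, v_p u − v_p w)`, `B = 5 + log H/log 2`; constant absorbed by `c10_omega_absorb` (Y3). -/
theorem matveevStep (hM : matveev2000_linearFormsLog_nf) :
    ∀ δ : ℝ, 0 < δ → ∃ κ : ℝ, ∀ u w : ℤ, u ≠ 0 → w ≠ 0 → ∀ s : ℤ, (s = 5 ∨ s = -5) →
      (u : ℝ) / w * Real.goldenRatio ^ s - 1 ≠ 0 →
      -Real.log (|(u : ℝ) / w * Real.goldenRatio ^ s - 1|) ≤
        κ * (((radical (u * w)).natAbs : ℕ) : ℝ) ^ δ * Real.log (2 + Real.log (max (|(u : ℝ)|) (|(w : ℝ)|))) := by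
  sorry

/-- Q4 (S, g3): `QNotSmall` mod Matveev-NF (`log|Q| = log|x₊| + log|x₋|`, g3 Q4a/Q4b, A3, Q4d; `Λ ≠ 0` by `Real.goldenRatio_irrational`). -/
theorem qNotSmall_of_matveev (hM : matveev2000_linearFormsLog_nf) : QNotSmall := by
  sorry

/-! ### 3 · The non-archimedean half with the CRUDE place cost (NEW): V1–V6, Y1–Y5
V1, V2, V4 are stated and PROVED for an arbitrary number field `K` (they are the whole of the K-arithmetic the crude
Yu step needs — no decomposition law); V5, V6 are golden-specific ring facts (PROVED); V3, Y1 are left as `S` statements. -/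

section AnyField

variable (K : Type*) [Field K] [NumberField K]

/-- V0 (XS, PROVED; pattern of `GoldenFromNFPencil.absNorm_radical_span_intCast_le`): `N((p)) = p^[K:ℚ]`. -/
theorem absNorm_span_natCast (p : ℕ) :
    Ideal.absNorm (Ideal.span {((p : ℤ) : 𝓞 K)}) = p ^ Module.finrank ℚ K := by
  rw [Ideal.absNorm_span_singleton, ← eq_intCast (algebraMap ℤ (𝓞 K)), Algebra.norm_algebraMap,
    Int.natAbs_pow, RingOfIntegers.rank]
  simp

/-- V1 (S, PROVED): every rational prime lies under some prime of `𝓞_K` (`(p) ≠ ⊤` since `N((p)) = p^[K:ℚ] ≠ 1`;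
`Ideal.exists_le_maximal`; a maximal ideal containing `p ≠ 0` is `≠ ⊥`). -/
theorem exists_prime_over (p : ℕ) (hp : p.Prime) :
    ∃ 𝔭 : IsDedekindDomain.HeightOneSpectrum (𝓞 K), ((p : ℤ) : 𝓞 K) ∈ 𝔭.asIdeal := by
  have hN := absNorm_span_natCast K p
  have hne : Ideal.span {((p : ℤ) : 𝓞 K)} ≠ ⊤ := by
    intro h
    have h1 : p ^ Module.finrank ℚ K = 1 := by rw [← hN, h, Ideal.absNorm_top]
    have h2 : 1 < p ^ Module.finrank ℚ K := Nat.one_lt_pow Module.finrank_pos.ne' hp.one_lt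
    omega
  obtain ⟨M, hM, hle⟩ := Ideal.exists_le_maximal _ hne
  have hbot : M ≠ ⊥ := by
    intro hb
    rw [hb, le_bot_iff, Ideal.span_singleton_eq_bot] at hle
    exact (Int.cast_ne_zero.mpr (by exact_mod_cast hp.ne_zero) : ((p : ℤ) : 𝓞 K) ≠ 0) hle
  exact ⟨⟨M, hM.isPrime, hbot⟩, hle (Ideal.mem_span_singleton_self _)⟩

/-- V2 (S, PROVED): the CRUDE norm facts for any `𝔭 ∋ p`: `N𝔭 ∣ p^[K:ℚ]`, `p ≤ N𝔭 ≤ p^[K:ℚ]` — NO splitting analysis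
(`Ideal.absNorm_dvd_absNorm_of_le`, V0, `Nat.dvd_prime_pow`, `one_lt_absNorm`). For `K = ℚ(√5)`, `[K:ℚ] = 2`
(`GoldenField.finrank_eq_two`). -/
theorem absNorm_prime_over {p : ℕ} (hp : p.Prime) (𝔭 : IsDedekindDomain.HeightOneSpectrum (𝓞 K))
    (h : ((p : ℤ) : 𝓞 K) ∈ 𝔭.asIdeal) :
    Ideal.absNorm 𝔭.asIdeal ∣ p ^ Module.finrank ℚ K ∧
      p ≤ Ideal.absNorm 𝔭.asIdeal ∧ Ideal.absNorm 𝔭.asIdeal ≤ p ^ Module.finrank ℚ K := by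
  have hle : Ideal.span {((p : ℤ) : 𝓞 K)} ≤ 𝔭.asIdeal := (Ideal.span_singleton_le_iff_mem _).mpr h
  have hdvd : Ideal.absNorm 𝔭.asIdeal ∣ p ^ Module.finrank ℚ K := by
    rw [← absNorm_span_natCast K p]
    exact Ideal.absNorm_dvd_absNorm_of_le hle
  have hpow : 0 < p ^ Module.finrank ℚ K := pow_pos hp.pos _
  refine ⟨hdvd, ?_, Nat.le_of_dvd hpow hdvd⟩
  obtain ⟨k, -, hk⟩ := (Nat.dvd_prime_pow hp).mp hdvd
  have hk0 : k ≠ 0 := by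
    rintro rfl
    have := NumberField.HeightOneSpectrum.one_lt_absNorm 𝔭
    rw [hk, pow_zero] at this
    exact lt_irrefl _ this
  rw [hk]
  exact Nat.le_self_pow hk0 p

/-- V3 (S+): `v_p(n)·log p ≤ −log |n|_𝔭` for a non-zero integer `n` and `𝔭 ∋ p`: `n = p^v·n'`, `|·|_𝔭` multiplicative,
`|n'|_𝔭 ≤ 1` (`NumberField.HeightOneSpectrum.adicAbv_intCast_le_one`), `|p|_𝔭 = N𝔭^{−ord_𝔭 p} ≤ N𝔭^{−1} ≤ p^{−1}`
(`Literature.IUT.LogVolume.adicAbv_eq_absNorm_zpow`, `intValuation_lt_one_iff_mem`, V2's `p ≤ N𝔭`). -/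
theorem padicVal_mul_log_le_neg_log_adicAbv {p : ℕ} (hp : p.Prime)
    (𝔭 : IsDedekindDomain.HeightOneSpectrum (𝓞 K)) (h : ((p : ℤ) : 𝓞 K) ∈ 𝔭.asIdeal) (n : ℤ) (hn : n ≠ 0) :
    (padicValInt p n : ℝ) * Real.log p ≤ -Real.log (NumberField.HeightOneSpectrum.adicAbv K 𝔭 (n : K)) := by
  sorry

/-- V4 (S, PROVED): `|m|_𝔭 = 1` for an integer `m` with `p ∤ m` and `𝔭 ∋ p` (Bezout `a p + b m = 1` ⇒ `m ∉ 𝔭`;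
`IsDedekindDomain.HeightOneSpectrum.adicAbv_coe_eq_one_iff`). -/
theorem adicAbv_intCast_eq_one {p : ℕ} (hp : p.Prime) (𝔭 : IsDedekindDomain.HeightOneSpectrum (𝓞 K))
    (h : ((p : ℤ) : 𝓞 K) ∈ 𝔭.asIdeal) (m : ℤ) (hm : ¬ (p : ℤ) ∣ m) :
    NumberField.HeightOneSpectrum.adicAbv K 𝔭 (m : K) = 1 := by
  obtain ⟨a, b, hab⟩ := (Nat.prime_iff_prime_int.mp hp).coprime_iff_not_dvd.mpr hm
  have hnot : ((m : ℤ) : 𝓞 K) ∉ 𝔭.asIdeal := by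
    intro hmem
    apply 𝔭.isPrime.ne_top
    rw [Ideal.eq_top_iff_one]
    have h1 : ((a * (p : ℤ) + b * m : ℤ) : 𝓞 K) = 1 := by rw [hab, Int.cast_one]
    simp only [Int.cast_add, Int.cast_mul] at h1
    rw [← h1]
    exact 𝔭.asIdeal.add_mem (𝔭.asIdeal.mul_mem_left _ h) (𝔭.asIdeal.mul_mem_left _ hmem)
  have e : (m : K) = algebraMap (𝓞 K) K ((m : ℤ) : 𝓞 K) := by simp
  rw [e]
  exact (IsDedekindDomain.HeightOneSpectrum.adicAbv_coe_eq_one_iff 𝔭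
    (NumberField.HeightOneSpectrum.one_lt_absNorm_nnreal 𝔭) _).mpr hnot

end AnyField

section GoldenAdic

variable [Fact (∀ r : ℚ, r ^ 2 ≠ (1 : ℚ) + 1 * r)]

/-- V5 (XS, PROVED): `|ω|_𝔭 = 1` at every prime of `𝓞_{ℚ(√5)}` (`ω(ω − 1) = 1`: a unit lies in no prime). -/
theorem adicAbv_omega_eq_one [NumberField (QuadraticAlgebra ℚ 1 1)]
    (𝔭 : IsDedekindDomain.HeightOneSpectrum (𝓞 (QuadraticAlgebra ℚ 1 1))) :
    NumberField.HeightOneSpectrum.adicAbv (QuadraticAlgebra ℚ 1 1) 𝔭 (ω : QuadraticAlgebra ℚ 1 1) = 1 := by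
  set θ : 𝓞 (QuadraticAlgebra ℚ 1 1) := ⟨ω, Summit.ABC.ABC.Theorems.GoldenField.isIntegral_omega⟩ with hθdef
  have hθ : θ * θ = θ + 1 := by
    rw [hθdef]; exact Summit.ABC.ABC.Theorems.GoldenFromNFPencil.theta_mul_theta
  have hunit : IsUnit θ := isUnit_iff_exists_inv.mpr ⟨θ - 1, by linear_combination hθ⟩
  have hnot : θ ∉ 𝔭.asIdeal := fun hmem => 𝔭.isPrime.ne_top (Ideal.eq_top_of_isUnit_mem _ hmem hunit)
  have e : (ω : QuadraticAlgebra ℚ 1 1) =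
      algebraMap (𝓞 (QuadraticAlgebra ℚ 1 1)) (QuadraticAlgebra ℚ 1 1) θ := by
    rw [hθdef]; rfl
  rw [e]
  exact (IsDedekindDomain.HeightOneSpectrum.adicAbv_coe_eq_one_iff 𝔭
    (NumberField.HeightOneSpectrum.one_lt_absNorm_nnreal 𝔭) _).mpr hnot

/-- V6 (XS, PROVED): `x₊ · x₋ = Q` and the Λ-forms in `K = ℚ(√5)`: `x₊ = u + (−3 − 5ω)w = ω⁵w·((u/w)ω⁻⁵ − 1)`,
`x₋ = u + (−8 + 5ω)w = −ω⁻⁵w·((−u/w)ω⁵ − 1)` (`ω² = ω + 1`, `ω⁵ = 5ω + 3`, `ω⁻⁵ = 5ω − 8`;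
cf. `GoldenFromNFPencil.formTwo_mul_formThree`). -/
theorem conj_lambda_form_K (u w : QuadraticAlgebra ℚ 1 1) (hw : w ≠ 0) :
    (u + (-3 - 5 * ω) * w) * (u + (-8 + 5 * ω) * w) = u ^ 2 - 11 * u * w - w ^ 2 ∧
    u + (-3 - 5 * ω) * w = (ω ^ 5 * w) * (u / w * (ω⁻¹) ^ 5 - 1) ∧
      u + (-8 + 5 * ω) * w = -((ω⁻¹) ^ 5 * w) * (-u / w * ω ^ 5 - 1) := by
  have hω : (ω : QuadraticAlgebra ℚ 1 1) * ω = ω + 1 := by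
    rw [QuadraticAlgebra.omega_mul_omega_eq_add, one_smul, one_smul, add_comm]
  have hω0 : (ω : QuadraticAlgebra ℚ 1 1) ≠ 0 := by
    intro h
    have := congrArg QuadraticAlgebra.im h
    simp at this
  have h5 : (ω : QuadraticAlgebra ℚ 1 1) ^ 5 = 5 * ω + 3 := by
    linear_combination (ω ^ 3 + ω ^ 2 + 2 * ω + 3) * hω
  have hinv5 : ((ω : QuadraticAlgebra ℚ 1 1)⁻¹) ^ 5 = 5 * ω - 8 := by
    have h1 : (ω : QuadraticAlgebra ℚ 1 1) ^ 5 * (5 * ω - 8) = 1 := by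
      rw [h5]; linear_combination (25 : QuadraticAlgebra ℚ 1 1) * hω
    rw [inv_pow]
    exact inv_eq_of_mul_eq_one_right h1
  refine ⟨?_, ?_, ?_⟩
  · linear_combination (-25 * w ^ 2) * hω
  · have e : (ω ^ 5 * w) * (u / w * (ω⁻¹) ^ 5 - 1) = u - (ω : QuadraticAlgebra ℚ 1 1) ^ 5 * w := by
      field_simp
    rw [e, h5]; ring
  · have e : -((ω⁻¹) ^ 5 * w) * (-u / w * ω ^ 5 - 1) = u + ((ω : QuadraticAlgebra ℚ 1 1)⁻¹) ^ 5 * w := by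
      field_simp
      ring
    rw [e, hinv5]; ring

/-- Y1 (S, the two-conjugate place inequality): for coprime `u, w`, `Q ≠ 0`, a prime `p | Q` and ANY `𝔭 ∋ p`:
`v_p(Q)·log p ≤ −log|Λ₊|_𝔭 − log|Λ₋|_𝔭` (V3 for `n = Q`; `|Q|_𝔭 = |x₊|_𝔭|x₋|_𝔭 = |Λ₊|_𝔭|Λ₋|_𝔭` by V6, `map_mul`, V4 for `w`
(`p ∤ w` from `GoldenFromNFPencil.isCoprime_quadForm_right`), V5). -/
theorem padicVal_log_le_two_lambda [NumberField (QuadraticAlgebra ℚ 1 1)] (u w : ℤ) (hcop : IsCoprime u w)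
    (hQ : u ^ 2 - 11 * u * w - w ^ 2 ≠ 0) (hw : w ≠ 0) {p : ℕ} (hp : p.Prime) (hpQ : (p : ℤ) ∣ u ^ 2 - 11 * u * w - w ^ 2)
    (𝔭 : IsDedekindDomain.HeightOneSpectrum (𝓞 (QuadraticAlgebra ℚ 1 1)))
    (h : ((p : ℤ) : 𝓞 (QuadraticAlgebra ℚ 1 1)) ∈ 𝔭.asIdeal) :
    (padicValInt p (u ^ 2 - 11 * u * w - w ^ 2) : ℝ) * Real.log p ≤
      -Real.log (NumberField.HeightOneSpectrum.adicAbv (QuadraticAlgebra ℚ 1 1) 𝔭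
          ((u : QuadraticAlgebra ℚ 1 1) / (w : QuadraticAlgebra ℚ 1 1) * (ω⁻¹) ^ 5 - 1)) +
      -Real.log (NumberField.HeightOneSpectrum.adicAbv (QuadraticAlgebra ℚ 1 1) 𝔭
          (-(u : QuadraticAlgebra ℚ 1 1) / (w : QuadraticAlgebra ℚ 1 1) * ω ^ 5 - 1)) := by
  sorry

end GoldenAdic

/-- Y3 (S, shared by Q4d and Y2): absorption of the Matveev–Yu constant into `rad^δ`:
`12·(32e)^{3(ω(n)+2)+2} · ∏_{p|n} log p ≤ C_δ · rad(n)^δ` (`exists_pow_card_primeFactors_le_mul_rpow` with `K = (32e)³`,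
`exists_prod_log_primeFactors_le_mul_rpow`, both at `δ/2`; `Nat.prod_primeFactors` = `rad`). -/
theorem c10_omega_absorb {δ : ℝ} (hδ : 0 < δ) :
    ∃ C : ℝ, 0 ≤ C ∧ ∀ n : ℕ, n ≠ 0 →
      12 * (16 * Real.exp 1 * 2) ^ (3 * (n.primeFactors.card + 2) + 2) * ∏ p ∈ n.primeFactors, Real.log (p : ℝ) ≤
        C * (∏ p ∈ n.primeFactors, (p : ℝ)) ^ δ := by
  sorry

/-- Y2 (M−, THE NON-ARCHIMEDEAN LOAD-BEARING STEP, mod Yu-NF; replaces g3 Q5b+Q5c): for coprime `u,w`, `uwQ ≠ 0`, every prime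
`p | Q`: `v_p(Q)·log p ≤ κ_δ rad(uw)^δ · p² · log(2 + log H)`. PROOF SHAPE: V1 gives `𝔭 ∋ p`; Y1; then TWICE the PROVED
`Dioph.evertseGyory2022_prop_4_2_4_finite_nf_of_yu hY (QuadraticAlgebra ℚ 1 1) 𝔭 (Option (Option ↥(u*w).natAbs.primeFactors))`
with `α none = −1`, `α (some none) = ω`, `α (some (some p)) = p`, `b` = (parity of sign, `∓5`, `v_p u − v_p w`), `card ≥ 2` ALWAYS,
`∏ α^b = (±u/w)·ω^{∓5}` (`Nat.factorization_prod_pow_eq_self` for `|u|,|w|`), `B = 5 + log H/log 2`; the theorem's factor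
`N𝔭/log N𝔭 ≤ p²/log 2` (V2), heights `logHeight₁ (p : K)/2 = log p` (`NumberField.logHeight₁_algebraMap`, `Pasten.logHeight₁_natCast_prime`),
`max(log p, m(2)) = log p` (`m(2) = 1/(log 6)³ < log 2`), `logHeight₁ (−1) = 0`, `logHeight₁ ω` a constant; Y3 absorbs `c₁₀·Ω`. -/
theorem yuStepSq (hY : yu2007_padicLogForm_logB_nf) :
    ∀ δ : ℝ, 0 < δ → ∃ κ : ℝ, ∀ u w : ℤ, IsCoprime u w → u * w * (u ^ 2 - 11 * u * w - w ^ 2) ≠ 0 →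
      ∀ p : ℕ, p.Prime → (p : ℤ) ∣ u ^ 2 - 11 * u * w - w ^ 2 →
        (padicValInt p (u ^ 2 - 11 * u * w - w ^ 2) : ℝ) * Real.log p ≤
          κ * (((radical (u * w)).natAbs : ℕ) : ℝ) ^ δ * (p : ℝ) ^ 2 *
            Real.log (2 + Real.log (max (|(u : ℝ)|) (|(w : ℝ)|))) := by
  sorry

/-- Y4 (XS, = g3 Q5d / k2 L4): `Σ_{p | n} p ≤ ∏_{p | n} p`, hence `Σ_{p|n} p² ≤ (∏_{p|n} p)²`. -/
theorem sum_sq_primeFactors_le_sq_prod (n : ℕ) :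
    ∑ p ∈ n.primeFactors, ((p : ℝ)) ^ 2 ≤ (∏ p ∈ n.primeFactors, (p : ℝ)) ^ 2 := by
  sorry

/-- Y5 (S, assembly): `QUpperSq` mod Yu-NF: `log|Q| = Σ_{p|Q} v_p(Q) log p` (`Literature.Barriers.ABC.log_eq_sum_factorization_mul_log`
at `n = |Q|`, `Nat.factorization_def`/`padicValInt`), Y2 termwise, Y4, `(∏_{p | Q} p : ℝ) = rad(Q).natAbs`
(`Int.radical_natAbs`-style bookkeeping as in `GoldenFromNFPencil.natAbs_radical_prod`). -/
theorem qUpperSq_of_yu (hY : yu2007_padicLogForm_logB_nf) : QUpperSq := by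
  sorry

/-! ### 4 · Net statements for the lead (sorry-free compositions) -/

/-- THIS STUB mod {Matveev-NF, Yu-NF} and the unconditional ℚ-line `UWHalf` (k2 Plan A), via the squared K-datum. -/
theorem sig_of_facts (hU : UWHalf) (hM : matveev2000_linearFormsLog_nf) (hY : yu2007_padicLogForm_logB_nf) : Sig :=
  sig_of_uwHalf_of_qSideRadSq hU (qSideRadSq_of_qNotSmall_of_qUpperSq (qNotSmall_of_matveev hM) (qUpperSq_of_yu hY))

/-! ### 5 · Sanity (family 3: the extremal identities behind the plan) -/

/-- S1 (`norm_num`): the crude-cost bookkeeping is tight on the stub's shape: at `m = q²` both sides of A1 agree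
(`min(q², q²) = q² = q^{2/3}(q²)^{2/3}`), e.g. `q = 8`, `m = 64`: `64 = 4 · 16`. -/
example : min (64 : ℝ) ((8 : ℝ) ^ 2) = 64 ∧ (4 : ℝ) * 16 = 64 := by norm_num

/-- S2 (`linear_combination`): `ω⁵ = 5ω + 3`, `ω(ω − 1) = 1` (so `ω⁻¹ = ω − 1`, V5) and `(5ω − 8)·ω⁵ = 1` (so `ω⁻⁵ = 5ω − 8`, V6),
checked in any commutative ring with `t² = t + 1`. -/
example {R : Type*} [CommRing R] (t : R) (ht : t * t = t + 1) :
    t ^ 5 = 5 * t + 3 ∧ t * (t - 1) = 1 ∧ (5 * t - 8) * (5 * t + 3) = 1 := by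
  refine ⟨?_, ?_, ?_⟩
  · linear_combination (t ^ 3 + t ^ 2 + 2 * t + 3) * ht
  · linear_combination ht
  · linear_combination (25 : R) * ht

/-- S3 (`norm_num`): the residual-regime witnesses (g2 census) are norm-small orbits: `Q(122,11) = 1`, `Q(1,-12) = -11 · (-1)`…
here `Q(13,1) = 25 = 5²` (ramified), `Q(12,1) = 11`, `Q(1,-12) = -11`: `rad Q² < min(rad u, rad w)` needs BOTH `u,w` rough. -/
example : (122 : ℤ) ^ 2 - 11 * 122 * 11 - 11 ^ 2 = 1 ∧ (13 : ℤ) ^ 2 - 11 * 13 * 1 - 1 ^ 2 = 25 ∧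
    (12 : ℤ) ^ 2 - 11 * 12 * 1 - 1 ^ 2 = 11 ∧ (1 : ℤ) ^ 2 - 11 * 1 * (-12) - (-12) ^ 2 = -11 := by
  norm_num

/-! ### 6 · Name certificates (elaboration = the names resolve) -/

example := @Literature.NumberTheory.DiophantineGeometry.Dioph.evertseGyory2022_prop_4_2_4_finite_nf_of_yu
example := @Literature.NumberTheory.DiophantineGeometry.Dioph.evertseGyory2022_prop_4_2_4_infinite_nf_of_matveev
example := @Literature.IUT.LogVolume.adicAbv_eq_absNorm_zpow
example := @IsDedekindDomain.HeightOneSpectrum.adicAbv_coe_eq_one_iff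
example := @NumberField.HeightOneSpectrum.adicAbv_intCast_le_one
example := @NumberField.HeightOneSpectrum.one_lt_absNorm
example := @Ideal.absNorm_dvd_absNorm_of_le
example := @Ideal.absNorm_span_singleton
example := @Algebra.norm_algebraMap
example := @NumberField.logHeight₁_algebraMap
example := @Literature.NumberTheory.DiophantineGeometry.Pasten.logHeight₁_natCast_prime
example := @Literature.NumberTheory.DiophantineGeometry.exists_pow_card_primeFactors_le_mul_rpow
example := @Literature.NumberTheory.DiophantineGeometry.exists_prod_log_primeFactors_le_mul_rpow
example := @Literature.Barriers.ABC.log_eq_sum_factorization_mul_log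
example := @Summit.ABC.ABC.Theorems.GoldenField.finrank_eq_two
example := @Summit.ABC.ABC.Theorems.GoldenField.numberField
example := @Summit.ABC.ABC.Theorems.GoldenFromNFPencil.formTwo_mul_formThree
example := @Summit.ABC.ABC.Theorems.GoldenFromNFPencil.isCoprime_quadForm_right
example := @Summit.ABC.ABC.Theorems.GoldenFromNFPencil.natAbs_radical_prod
example := @Real.goldenRatio_irrational

end Summit.ABC.ABC.Cruxes.GoldenCuspShadow.ConjugateK3G4
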